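import Summits.HodgeConjecture.HodgeConjecture.Theorems.SignSymmetricPowersSymmetricA3PlaneJet
import Summits.HodgeConjecture.HodgeConjecture.Theorems.SignSymmetricPowersNodalFormPair

/-!
# K1-B LINK-F witnesses (route `SignSymmetricPowers`, item stmt-HodgeConjecture-19716) — the symmetric `A₃`
# form at `e₄`, II: the datum

Helper file for the registered stub `stub_signConfluenceLinkF` (K1-B line `andre-zariski` v12b; memo
`K1B-LINKF-PLAN-g23.md` §2), continuing `SignSymmetricPowersSymmetricA3PlaneJet.lean`: with the coefficients
`c₀ = 4/(2n+4)`, `c₁ = 2/((2n+4)·2^{n+1})`, `c₃ = 1/(2n+4)²` the split `A₃`-witness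
`f₁ = x₄^{2n+2}(x₁² + x₂x₃) + x₄^{2n}x₀⁴ + c₀x₀^{2n+4} + c₁x₁^{2n+4} + x₂^{2n+4} + c₃x₃^{2n+4}` has `e₄` as its ONLY
singular point, and together with `g₀ = x₄^{2n+4}`, `g₂ = x₀²x₄^{2n+2}` it is a symmetric `A₃` datum
`IsSymmetricA3Datum f₁ g₀ g₂ 4 0 γ` (`γ = (−1,−1,1,1,1)`, `HodgeTheory/PicardLefschetzSymmetricA3`) made of
ι-even forms of degree `2n + 4` — the Π/pair confluence input of F-B2PL (`picardLefschetz_symmetricA3`).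
Landed `--supports stmt-HodgeConjecture-19716` as a helper. Sorry-free; axioms standard.

Uniqueness (`b := z₄ ≠ 0`; `b = 0` forces `z = 0`): the transversal equations give `z₁ = 0 ∨ |z₁²| = 2|b|²`,
`z₂ = z₃ = 0 ∨ |z₂z₃| = |b|²` (as in `SignSymmetricPowersNodalFormPair`), the kernel equation `z₀ = 0 ∨ |z₀| = |b|`,
and `x₄∂₄f₁ = 0` reads `(2n+2) b² (z₁² + z₂z₃) = −2n z₀⁴`, so `|z₁² + z₂z₃| ≤ (2n/(2n+2))|b|² < |b|²`, while a
non-zero transversal part has `|z₁² + z₂z₃| ≥ |b|²`; hence `z₁ = z₂ = z₃ = 0`, then `z₀ = 0`, `z = b • e₄`.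
-/

set_option linter.dupNamespace false

noncomputable section

namespace Summit.HodgeConjecture.HodgeConjecture.Theorems.SignSymmetricPowersSymmetricA3Plane

open MvPolynomial Literature.AlgebraicGeometry.Motives Literature.AlgebraicGeometry.HodgeTheory
open Summit.HodgeConjecture.HodgeConjecture.Theorems.SignSymmetricPowersNodalFormsTools
open Summit.HodgeConjecture.HodgeConjecture.Theorems.SignSymmetricPowersNodalFormPair
open Summit.HodgeConjecture.HodgeConjecture.Theorems.SignSymmetricPowersSymmetricA3PlaneJet

/-- **`e₄` is the only singular point of the `A₃`-witness** (for `c₀(2n+4) = 4`, `c₁(2n+4)2^{n+1} = 2`,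
`c₃(2n+4)² = 1`). -/
theorem eq_smul_of_grad_a3PlaneForm (n : ℕ) {c₀ c₁ c₃ : ℂ} (hc₀ : c₀ * (2 * n + 4) = 4)
    (hc₁ : c₁ * (2 * n + 4) * (2 : ℂ) ^ (n + 1) = 2) (hc₃ : c₃ * (2 * n + 4) ^ 2 = 1)
    (z : Fin 5 → ℂ) (hz : z ≠ 0)
    (hgrad : ∀ j, eval z (pderiv j (X 4 ^ (2 * n + 2) * (X 1 ^ 2 + X 2 * X 3) + X 4 ^ (2 * n) * X 0 ^ 4 +
      C c₀ * X 0 ^ (2 * n + 4) + C c₁ * X 1 ^ (2 * n + 4) + X 2 ^ (2 * n + 4) + C c₃ * X 3 ^ (2 * n + 4) :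
        MvPolynomial (Fin 5) ℂ)) = 0) :
    z = z 4 • (Pi.single 4 1 : Fin 5 → ℂ) := by
  have hd : (2 * (n : ℂ) + 4) ≠ 0 := by exact_mod_cast (show 2 * n + 4 ≠ 0 by omega)
  have hd2 : (2 * (n : ℂ) + 2) ≠ 0 := by exact_mod_cast (show 2 * n + 2 ≠ 0 by omega)
  have hc₁0 : c₁ ≠ 0 := by rintro rfl; norm_num at hc₁
  have hc₃0 : c₃ ≠ 0 := by rintro rfl; norm_num at hc₃
  have hg : ∀ j, eval z ((![C 4 * X 4 ^ (2 * n) * X 0 ^ 3 + C (c₀ * (2 * (n : ℂ) + 4)) * X 0 ^ (2 * n + 3),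
          C 2 * X 4 ^ (2 * n + 2) * X 1 + C (c₁ * (2 * (n : ℂ) + 4)) * X 1 ^ (2 * n + 3),
          X 4 ^ (2 * n + 2) * X 3 + C (2 * (n : ℂ) + 4) * X 2 ^ (2 * n + 3),
          X 4 ^ (2 * n + 2) * X 2 + C (c₃ * (2 * (n : ℂ) + 4)) * X 3 ^ (2 * n + 3),
          C (2 * (n : ℂ) + 2) * X 4 ^ (2 * n + 1) * (X 1 ^ 2 + X 2 * X 3) +
            C (2 * (n : ℂ)) * X 4 ^ (2 * n - 1) * X 0 ^ 4] : Fin 5 → MvPolynomial (Fin 5) ℂ) j) = 0 :=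
    fun j => by rw [← pderiv_a3PlaneForm_eq n c₀ c₁ c₃ j]; exact hgrad j
  have g0 := hg 0
  have g1 := hg 1
  have g2 := hg 2
  have g3 := hg 3
  have g4 := hg 4
  simp only [Matrix.cons_val_zero, Matrix.cons_val_one, Matrix.cons_val_two, Matrix.cons_val_three,
    Matrix.cons_val_four, Matrix.head_cons, Matrix.tail_cons, map_add, map_mul, map_pow, eval_X, eval_C]
    at g0 g1 g2 g3 g4
  rw [hc₀] at g0
  have hpa : ∀ x : ℂ, 2 * (n : ℂ) * x ^ (2 * n - 1) * x = 2 * (n : ℂ) * x ^ (2 * n) := by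
    intro x
    rcases Nat.eq_zero_or_pos n with rfl | hn
    · simp
    · rw [mul_assoc, ← pow_succ, Nat.sub_add_cancel (by omega)]
  -- `x₄ ∂₄ f₁ = 0`
  have e4 : (2 * (n : ℂ) + 2) * z 4 ^ (2 * n + 2) * (z 1 ^ 2 + z 2 * z 3) + 2 * n * z 4 ^ (2 * n) * z 0 ^ 4 = 0 := by
    linear_combination z 4 * g4 - z 0 ^ 4 * hpa (z 4)
  by_cases hb : z 4 = 0
  · -- `b = 0` forces `z = 0`
    exfalso
    apply hz
    rw [hb, zero_pow (by omega : 2 * n + 2 ≠ 0), mul_zero, zero_mul, zero_add] at g1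
    rw [hb, zero_pow (by omega : 2 * n + 2 ≠ 0), zero_mul, zero_add] at g2 g3
    have e1z : z 1 = 0 :=
      (pow_eq_zero_iff (by omega : 2 * n + 3 ≠ 0)).1 ((mul_eq_zero.1 g1).resolve_left (mul_ne_zero hc₁0 hd))
    have e2z : z 2 = 0 := (pow_eq_zero_iff (by omega : 2 * n + 3 ≠ 0)).1 ((mul_eq_zero.1 g2).resolve_left hd)
    have e3z : z 3 = 0 :=
      (pow_eq_zero_iff (by omega : 2 * n + 3 ≠ 0)).1 ((mul_eq_zero.1 g3).resolve_left (mul_ne_zero hc₃0 hd))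
    have e0z : z 0 = 0 := by
      rw [hb] at g0
      rcases Nat.eq_zero_or_pos n with rfl | hn
      · have h8 : (8 : ℂ) * z 0 ^ 3 = 0 := by
          simp only [mul_zero, zero_add, pow_zero, mul_one] at g0
          linear_combination g0
        exact (pow_eq_zero_iff three_ne_zero).1 ((mul_eq_zero.1 h8).resolve_left (by norm_num))
      · rw [zero_pow (by omega : 2 * n ≠ 0), mul_zero, zero_mul, zero_add] at g0
        exact (pow_eq_zero_iff (by omega : 2 * n + 3 ≠ 0)).1
          ((mul_eq_zero.1 g0).resolve_left (by norm_num : (4 : ℂ) ≠ 0))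
    funext i
    fin_cases i <;> simp [e0z, e1z, e2z, e3z, hb]
  · have hbpos : 0 < ‖z 4‖ := norm_pos_iff.2 hb
    have hb2 : 0 < ‖z 4‖ ^ 2 := by positivity
    -- transversal dichotomy for `z₁` (`ρ₁ = 2`)
    have T1 : z 1 = 0 ∨ ‖z 1 ^ 2‖ = 2 * ‖z 4‖ ^ 2 := by
      by_cases h1 : z 1 = 0
      · exact Or.inl h1
      · right
        have h1' : c₁ * (2 * n + 4) * z 1 ^ (2 * n + 2) = -(2 * z 4 ^ (2 * n + 2)) := by
          apply mul_left_cancel₀ h1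
          linear_combination g1
        have hpow : (z 1 ^ 2) ^ (n + 1) = -(((2 : ℂ) * z 4 ^ 2) ^ (n + 1)) := by
          have h2 : (2 : ℂ) * (z 1 ^ 2) ^ (n + 1) = 2 * -(((2 : ℂ) * z 4 ^ 2) ^ (n + 1)) := by
            rw [show (z 1 ^ 2) ^ (n + 1) = z 1 ^ (2 * n + 2) by ring,
              show ((2 : ℂ) * z 4 ^ 2) ^ (n + 1) = (2 : ℂ) ^ (n + 1) * z 4 ^ (2 * n + 2) by ring]
            linear_combination (2 : ℂ) ^ (n + 1) * h1' - z 1 ^ (2 * n + 2) * hc₁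
          exact mul_left_cancel₀ two_ne_zero h2
        rw [norm_eq_norm_of_pow_eq (Nat.succ_ne_zero n) (Or.inr hpow), norm_mul, norm_pow, Complex.norm_ofNat]
    -- transversal dichotomy for `(z₂, z₃)` (`ρ₂ = 1`)
    have T2 : (z 2 = 0 ∧ z 3 = 0) ∨ ‖z 2 * z 3‖ = ‖z 4‖ ^ 2 := by
      by_cases hv : z 2 * z 3 = 0
      · left
        rcases mul_eq_zero.1 hv with h2 | h3
        · refine ⟨h2, ?_⟩
          rw [h2, zero_pow (by omega : 2 * n + 3 ≠ 0), mul_zero, add_zero] at g2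
          exact (mul_eq_zero.1 g2).resolve_left (pow_ne_zero _ hb)
        · refine ⟨?_, h3⟩
          rw [h3, zero_pow (by omega : 2 * n + 3 ≠ 0), mul_zero, add_zero] at g3
          exact (mul_eq_zero.1 g3).resolve_left (pow_ne_zero _ hb)
      · right
        have g2' : (2 * (n : ℂ) + 4) * z 2 ^ (2 * n + 3) = -(z 4 ^ (2 * n + 2) * z 3) := by
          linear_combination g2
        have g3' : c₃ * (2 * (n : ℂ) + 4) * z 3 ^ (2 * n + 3) = -(z 4 ^ (2 * n + 2) * z 2) := by
          linear_combination g3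
        have hP : c₃ * (2 * (n : ℂ) + 4) ^ 2 * (z 2 * z 3) ^ (2 * n + 2) * (z 2 * z 3) =
            z 4 ^ (4 * n + 4) * (z 2 * z 3) := by
          calc c₃ * (2 * (n : ℂ) + 4) ^ 2 * (z 2 * z 3) ^ (2 * n + 2) * (z 2 * z 3)
              = ((2 * (n : ℂ) + 4) * z 2 ^ (2 * n + 3)) * (c₃ * (2 * (n : ℂ) + 4) * z 3 ^ (2 * n + 3)) := by
                ring
            _ = (-(z 4 ^ (2 * n + 2) * z 3)) * (-(z 4 ^ (2 * n + 2) * z 2)) := by rw [g2', g3']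
            _ = z 4 ^ (4 * n + 4) * (z 2 * z 3) := by ring
        have hP' := mul_right_cancel₀ hv hP
        have hpow : (z 2 * z 3) ^ (2 * n + 2) = (z 4 ^ 2) ^ (2 * n + 2) := by
          rw [show (z 4 ^ 2) ^ (2 * n + 2) = z 4 ^ (4 * n + 4) by ring]
          linear_combination hP' - (z 2 * z 3) ^ (2 * n + 2) * hc₃
        rw [norm_eq_norm_of_pow_eq (by omega : 2 * n + 2 ≠ 0) (Or.inl hpow), norm_pow]
    -- kernel dichotomy for `z₀`
    have T0 : z 0 = 0 ∨ (0 < n ∧ ‖z 0‖ = ‖z 4‖) := by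
      by_cases h0 : z 0 = 0
      · exact Or.inl h0
      · right
        rcases Nat.eq_zero_or_pos n with rfl | hn
        · exfalso
          have h8 : (8 : ℂ) * z 0 ^ 3 = 0 := by
            simp only [mul_zero, zero_add, pow_zero, mul_one] at g0
            linear_combination g0
          exact h0 ((pow_eq_zero_iff three_ne_zero).1 ((mul_eq_zero.1 h8).resolve_left (by norm_num)))
        · refine ⟨hn, ?_⟩
          have h0' : (4 : ℂ) * z 0 ^ (2 * n) = -(4 * z 4 ^ (2 * n)) := by
            have h3 : z 0 ^ 3 ≠ 0 := pow_ne_zero _ h0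
            apply mul_left_cancel₀ h3
            linear_combination g0
          have hpow : z 0 ^ (2 * n) = -(z 4 ^ (2 * n)) := by linear_combination h0' / 4
          exact norm_eq_norm_of_pow_eq (by omega : 2 * n ≠ 0) (Or.inr hpow)
    -- the transversal part vanishes
    have hQ0 : z 1 = 0 ∧ z 2 = 0 ∧ z 3 = 0 := by
      by_contra hne
      -- lower bound `|Q| ≥ |b|²`
      have hQge : ‖z 4‖ ^ 2 ≤ ‖z 1 ^ 2 + z 2 * z 3‖ := by
        rcases T1 with h1 | h1 <;> rcases T2 with ⟨h2, h3⟩ | h23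
        · exact absurd ⟨h1, h2, h3⟩ hne
        · rw [h1, zero_pow two_ne_zero, zero_add, h23]
        · rw [h2, zero_mul, add_zero, h1]
          nlinarith
        · have hsub : ‖z 1 ^ 2‖ ≤ ‖z 1 ^ 2 + z 2 * z 3‖ + ‖z 2 * z 3‖ := by
            have h := norm_sub_le (z 1 ^ 2 + z 2 * z 3) (z 2 * z 3)
            rwa [add_sub_cancel_right] at h
          rw [h1, h23] at hsub
          linarith
      -- upper bound `(2n+2)|b|²|Q| = 2n|z₀|⁴ ≤ 2n|b|⁴`
      have e4' : (2 * (n : ℂ) + 2) * z 4 ^ 2 * (z 1 ^ 2 + z 2 * z 3) = -(2 * n * z 0 ^ 4) := by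
        have hw : z 4 ^ (2 * n) ≠ 0 := pow_ne_zero _ hb
        apply mul_left_cancel₀ hw
        linear_combination e4
      have hc : ‖(2 * (n : ℂ) + 2)‖ = 2 * (n : ℝ) + 2 := by
        rw [show (2 * (n : ℂ) + 2) = ((2 * (n : ℝ) + 2 : ℝ) : ℂ) by push_cast; ring]
        rw [Complex.norm_real, Real.norm_of_nonneg (by positivity)]
      have hc2 : ‖(2 * (n : ℂ))‖ = 2 * (n : ℝ) := by
        rw [show (2 * (n : ℂ)) = ((2 * (n : ℝ) : ℝ) : ℂ) by push_cast; ring]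
        rw [Complex.norm_real, Real.norm_of_nonneg (by positivity)]
      have key : (2 * (n : ℝ) + 2) * ‖z 4‖ ^ 2 * ‖z 1 ^ 2 + z 2 * z 3‖ = 2 * n * ‖z 0‖ ^ 4 := by
        have h := congrArg norm e4'
        rwa [norm_mul, norm_mul, norm_pow, hc, norm_neg, norm_mul, hc2, norm_pow] at h
      have hz0 : ‖z 0‖ ^ 4 ≤ ‖z 4‖ ^ 4 := by
        rcases T0 with h0 | ⟨-, h0⟩
        · rw [h0, norm_zero, zero_pow four_ne_zero]; positivity
        · rw [h0]
      have hnn : (0 : ℝ) ≤ n := Nat.cast_nonneg n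
      nlinarith [mul_le_mul_of_nonneg_left hQge (by positivity : (0:ℝ) ≤ (2 * (n : ℝ) + 2) * ‖z 4‖ ^ 2),
        mul_le_mul_of_nonneg_left hz0 (by positivity : (0:ℝ) ≤ 2 * (n : ℝ))]
    obtain ⟨e1z, e2z, e3z⟩ := hQ0
    have e0z : z 0 = 0 := by
      rcases T0 with h0 | ⟨hn, -⟩
      · exact h0
      · rw [e1z, e2z, e3z] at e4
        have h : 2 * (n : ℂ) * z 4 ^ (2 * n) * z 0 ^ 4 = 0 := by linear_combination e4
        have hn0 : (2 * (n : ℂ)) ≠ 0 := by exact_mod_cast (show 2 * n ≠ 0 by omega)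
        exact (pow_eq_zero_iff four_ne_zero).1
          ((mul_eq_zero.1 h).resolve_left (mul_ne_zero hn0 (pow_ne_zero _ hb)))
    funext i
    fin_cases i <;> simp [e0z, e1z, e2z, e3z]

/-- **The symmetric `A₃` datum at `e₄` (Π/pair confluence input of F-B2PL)**: for every `n`, with
`c₀ = 4/(2n+4)`, `c₁ = 2/((2n+4)2^{n+1})`, `c₃ = 1/(2n+4)²`, the forms `f₁` (the split `A₃`-witness),
`g₀ = x₄^{2n+4}`, `g₂ = x₀² x₄^{2n+2}` are homogeneous of degree `2n + 4`, ι-even, and satisfy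
`IsSymmetricA3Datum f₁ g₀ g₂ 4 0 γ` for `γ = (−1,−1,1,1,1)`. -/
theorem exists_symmetricA3Datum_plane (n : ℕ) :
    ∃ f₁ g₀ g₂ : MvPolynomial (Fin 5) ℂ, f₁.IsHomogeneous (2 * n + 4) ∧ g₀.IsHomogeneous (2 * n + 4) ∧
      g₂.IsHomogeneous (2 * n + 4) ∧ (∀ e : Fin 5 →₀ ℕ, ¬ Even (e 0 + e 1) → f₁.coeff e = 0) ∧
      (∀ e : Fin 5 →₀ ℕ, ¬ Even (e 0 + e 1) → g₀.coeff e = 0) ∧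
      (∀ e : Fin 5 →₀ ℕ, ¬ Even (e 0 + e 1) → g₂.coeff e = 0) ∧
      IsSymmetricA3Datum f₁ g₀ g₂ 4 0 (fun i : Fin 5 => if (i : ℕ) < 2 then (-1 : ℂˣ) else 1) := by
  have hd : (2 * (n : ℂ) + 4) ≠ 0 := by exact_mod_cast (show 2 * n + 4 ≠ 0 by omega)
  set c₀ : ℂ := 4 / (2 * n + 4) with hc₀
  set c₁ : ℂ := 2 / ((2 * n + 4) * 2 ^ (n + 1)) with hc₁
  set c₃ : ℂ := 1 / (2 * n + 4) ^ 2 with hc₃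
  have hc₀' : c₀ * (2 * n + 4) = 4 := by rw [hc₀]; field_simp
  have hc₁' : c₁ * (2 * n + 4) * (2 : ℂ) ^ (n + 1) = 2 := by rw [hc₁]; field_simp
  have hc₃' : c₃ * (2 * n + 4) ^ 2 = 1 := by rw [hc₃]; field_simp
  have hX : ∀ i : Fin 5, (X i : MvPolynomial (Fin 5) ℂ).IsHomogeneous 1 := fun i => isHomogeneous_X ℂ i
  -- ι-evenness of the three forms, by sign invariance
  have h2n : Even (2 * n) := even_two_mul n
  have h2n2 : Even (2 * n + 2) := h2n.add ⟨1, rfl⟩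
  have h2n4 : Even (2 * n + 4) := h2n.add ⟨2, rfl⟩
  have hf₁ : ∀ e : Fin 5 →₀ ℕ, ¬ Even (e 0 + e 1) → coeff e (X 4 ^ (2 * n + 2) * (X 1 ^ 2 + X 2 * X 3) + X 4 ^ (2 * n) * X 0 ^ 4 +
      C c₀ * X 0 ^ (2 * n + 4) + C c₁ * X 1 ^ (2 * n + 4) + X 2 ^ (2 * n + 4) + C c₃ * X 3 ^ (2 * n + 4) :
        MvPolynomial (Fin 5) ℂ) = 0 := by
    intro e he
    refine coeff_eq_zero_of_sign_aeval_eq _ ?_ e he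
    simp +decide only [map_add, map_mul, map_pow, sign_aeval_X, aeval_C, algebraMap_eq, if_true, if_false,
      map_one, one_mul, map_neg, neg_one_mul, neg_sq, h2n4.neg_pow]
    rw [show (-X 0 : MvPolynomial (Fin 5) ℂ) ^ 4 = X 0 ^ 4 by ring]
  have hg₀ : ∀ e : Fin 5 →₀ ℕ, ¬ Even (e 0 + e 1) → coeff e (X 4 ^ (2 * n + 4) : MvPolynomial (Fin 5) ℂ) = 0 := by
    intro e he
    refine coeff_eq_zero_of_sign_aeval_eq _ ?_ e he
    simp +decide only [map_pow, sign_aeval_X, if_false, map_one, one_mul]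
  have hg₂ : ∀ e : Fin 5 →₀ ℕ, ¬ Even (e 0 + e 1) →
      coeff e (X 0 ^ 2 * X 4 ^ (2 * n + 2) : MvPolynomial (Fin 5) ℂ) = 0 := by
    intro e he
    refine coeff_eq_zero_of_sign_aeval_eq _ ?_ e he
    simp +decide only [map_mul, map_pow, sign_aeval_X, if_true, if_false, map_one, one_mul, map_neg, neg_one_mul,
      neg_sq]
  obtain ⟨jgrad, jrank, jcol, jcubic, jquartic⟩ := jets_a3PlaneForm n c₀ c₁ c₃ hc₀'
  refine ⟨(X 4 ^ (2 * n + 2) * (X 1 ^ 2 + X 2 * X 3) + X 4 ^ (2 * n) * X 0 ^ 4 +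
      C c₀ * X 0 ^ (2 * n + 4) + C c₁ * X 1 ^ (2 * n + 4) + X 2 ^ (2 * n + 4) + C c₃ * X 3 ^ (2 * n + 4) :
        MvPolynomial (Fin 5) ℂ), X 4 ^ (2 * n + 4), X 0 ^ 2 * X 4 ^ (2 * n + 2), ?_, by simpa using (hX 4).pow (2 * n + 4), ?_,
    hf₁, hg₀, hg₂, ?_⟩
  · -- homogeneity of `f₁`
    have hA : (X 4 ^ (2 * n + 2) * (X 1 ^ 2 + X 2 * X 3) : MvPolynomial (Fin 5) ℂ).IsHomogeneous (2 * n + 4) := by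
      have h := ((hX 4).pow (2 * n + 2)).mul (((hX 1).pow 2).add ((hX 2).mul (hX 3)))
      rwa [show 1 * (2 * n + 2) + 1 * 2 = 2 * n + 4 by ring] at h
    have hB : (X 4 ^ (2 * n) * X 0 ^ 4 : MvPolynomial (Fin 5) ℂ).IsHomogeneous (2 * n + 4) := by
      have h := ((hX 4).pow (2 * n)).mul ((hX 0).pow 4)
      rwa [show 1 * (2 * n) + 1 * 4 = 2 * n + 4 by ring] at h
    have hP : ∀ i : Fin 5, (X i ^ (2 * n + 4) : MvPolynomial (Fin 5) ℂ).IsHomogeneous (2 * n + 4) :=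
      fun i => by simpa using (hX i).pow (2 * n + 4)
    have hC : ∀ (c : ℂ) (i : Fin 5), (C c * X i ^ (2 * n + 4) : MvPolynomial (Fin 5) ℂ).IsHomogeneous
        (2 * n + 4) := fun c i => by simpa using (isHomogeneous_C (Fin 5) c).mul (hP i)
    exact ((((hA.add hB).add (hC c₀ 0)).add (hC c₁ 1)).add (hP 2)).add (hC c₃ 3)
  · have h := ((hX 0).pow 2).mul ((hX 4).pow (2 * n + 2))
    rwa [show 1 * 2 + 1 * (2 * n + 2) = 2 * n + 4 by ring] at h
  · -- the datum
    refine ⟨by decide, jgrad, fun z hz hgrad => ⟨z 4, eq_smul_of_grad_a3PlaneForm n hc₀' hc₁' hc₃' z hz hgrad⟩,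
      jrank, jcol, jcubic, jquartic, ?_, ?_, ?_, ?_, ?_, ?_, ?_, ?_, ?_⟩
    · simp
    · simp
    · intro i
      fin_cases i <;> simp [Derivation.leibniz, Derivation.leibniz_pow, pderiv_X]
    · simp [Derivation.leibniz, Derivation.leibniz_pow, pderiv_X]
    · intro i
      fin_cases i <;> simp
    · exact signUnits_two_mem_diagonalStabilizer _ hf₁
    · exact signUnits_two_mem_diagonalStabilizer _ hg₀
    · exact signUnits_two_mem_diagonalStabilizer _ hg₂
    · simp

end Summit.HodgeConjecture.HodgeConjecture.Theorems.SignSymmetricPowersSymmetricA3Plane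

end
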